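import Summits.QuantumFields.GaugeBoot.Rows.GLYZc1D3BindB2
import Summits.QuantumFields.GaugeBoot.Eqs.BindKitZ
import HarnessLib

/-!
# Gauge-boot: binding kit for AGGREGATED equality rows (kz families, `_of_feasible_agg` certificates)

Cell `pub-gaugeboot` (HOME `run/shared/lean/pub/pub-gaugeboot/`), seat lean1 (torus bindings; FANOUT-PLAN A126 (2)(c), A148 (2),
A155 (2): kz-L2-H-3D rows C1–C2 first).

HONEST FRAMING (page 1 of every file of this cell): certified bounds on lattice expectations at STATED coupling,
gauge group, dimension and torus size; NOT a mass gap, NOT a continuum limit, NOT a string tension, NOT large `N`.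
The venture is explicitly NOT Yang–Mills-summit-bearing (barriers `FixedCouplingUltralocality`,
`PerturbativeInvisibility`).

A kz certificate in aggregated-equality form (lean3, `Certificates/<Fam>b<β>{Up,Lo}`) uses the problem's equality rows only
through ONE combination row `RW = [(rhs, [(v, c_v), …])]` over ALL columns `v = 0 … n−1` (sorted); lean2 proves that the same
row, INTEGER-CODED in its own term order (`Eqs/BindKitZ`: terms `(label code, z)`, coefficient `z / M`), vanishes on the torus
state.  The two rows have `n` ≈ 10³ terms, too many for a kernel permutation test; instead the seat supplies the sorting
permutation `σ` as DATA and the kernel checks (`aggOK`, all list walks, no search): right-hand side `0`; lean3's columns are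
exactly `0, 1, …, n−1`; `|ts| = |σ| = n` and every `i < n` occurs in `σ` (so `σ` is a permutation of `range n`); and for every
column `v`, lean2's term number `σ_v` carries the label code of `v` and the coefficient `c_v`.  `sum_eq_of_aggOK` turns
lean2's vanishing row sum into lean3's `heq`/`hagg` hypothesis `Σ_v c_v · f (label v) = rhs`, for any valuation `f` of words
(the torus expectations) whose labels decode through lean2's `BindN.wdg 3`.
-/

noncomputable section

open Literature.MathematicalPhysics.QuantumFieldTheory
open Summit.QuantumFields.GaugeBoot.Certificates Summit.QuantumFields.GaugeBoot.Certificates.Sparse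

namespace Summit.QuantumFields.GaugeBoot

namespace AggBind

/-- **The aggregated-row data check** (see the module docstring): `n` columns, label codes `code`, lean3's row `rw`,
lean2's coded terms `ts` with common denominator `M`, and the seat's sorting permutation `σ` (term `σ_v` ↔ column `v`). -/
def aggOK (n : ℕ) (code : ℕ → ℕ) (rw : ℚ × List (ℕ × ℚ)) (ts : List (ℕ × ℤ)) (M : ℕ) (σ : List ℕ) : Bool :=
  decide (rw.1 = 0) && decide (rw.2.map Prod.fst = List.range n) && decide (ts.length = n) && decide (σ.length = n) &&
    (List.range n).all (fun i => σ.contains i) &&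
    (List.range n).all (fun v =>
      decide ((ts.getD (σ.getD v 0) (0, 0)).1 = code v) &&
      decide ((((ts.getD (σ.getD v 0) (0, 0)).2 : ℚ) / M) = (rw.2.getD v (0, 0)).2))

/-! ## List lemmas -/

/-- A list is the map of its `getD` over `range length`. [folklore] -/
theorem map_getD_range {α : Type*} (l : List α) (d : α) : (List.range l.length).map (fun i => l.getD i d) = l := by
  refine List.ext_getElem (by simp) fun i h₁ h₂ => ?_
  rw [List.getElem_map, List.getElem_range, List.getD_eq_getElem]

/-- A list of length `n` containing every `i < n` is a permutation of `range n`. [folklore] -/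
theorem perm_range_of_forall_mem {n : ℕ} {σ : List ℕ} (hlen : σ.length = n) (hmem : ∀ i < n, i ∈ σ) :
    σ.Perm (List.range n) := by
  have hsub : List.range n ⊆ σ := fun i hi => hmem i (List.mem_range.mp hi)
  exact ((List.subperm_of_subset (List.nodup_range) hsub).perm_of_length_le (by simp [hlen])).symm

/-- The value of lean2's decoded aggregated row: the `c1` components vanish. -/
theorem sum_decWZ (f : Word 3 → ℝ) (cβ : ℝ) (M : ℕ) : ∀ ts : List (ℕ × ℤ),
    ((BindZ.decWZ 3 ts M).map fun t => (((t.2.1 : ℚ) : ℝ) + ((t.2.2 : ℚ) : ℝ) * cβ) * f t.1).sum =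
      (ts.map fun t => ((((t.2 : ℚ) / M : ℚ)) : ℝ) * f (BindN.wdg 3 t.1)).sum
  | [] => by simp [BindZ.decWZ]
  | t :: ts => by
    have ih := sum_decWZ f cβ M ts
    simp only [BindZ.decWZ, List.map_cons, List.sum_cons, List.map_map, Function.comp_def] at ih ⊢
    rw [ih]; push_cast; ring

/-! ## The check implies lean3's aggregated equality -/

/-- **From the aggregated-row data check to lean3's `heq`.**  If `aggOK n code rw ts M σ` holds, the labels decode through
lean2's decoder (`lab v = wdg 3 (code v)` for `v < n`), and lean2's decoded row vanishes at the valuation `f`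
(`cβ` = the `c1` weight, irrelevant since those components are `0`), then `Σ_{v<n} rw_v · f (lab v) = rhs`. -/
theorem sum_eq_of_aggOK {n : ℕ} {code : ℕ → ℕ} {lab : ℕ → Word 3} (hlab : ∀ v < n, lab v = BindN.wdg 3 (code v))
    (f : Word 3 → ℝ) (cβ : ℝ) {rw : ℚ × List (ℕ × ℚ)} {ts : List (ℕ × ℤ)} {M : ℕ} {σ : List ℕ}
    (h : aggOK n code rw ts M σ = true)
    (hE : ((BindZ.decWZ 3 ts M).map fun t => (((t.2.1 : ℚ) : ℝ) + ((t.2.2 : ℚ) : ℝ) * cβ) * f t.1).sum = 0) :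
    ∑ v : Fin n, (sget rw.2 v.val : ℝ) * f (lab v.val) = (rw.1 : ℝ) := by
  simp only [aggOK, Bool.and_eq_true, decide_eq_true_eq, List.all_eq_true, List.mem_range] at h
  obtain ⟨⟨⟨⟨⟨hrhs, hcols⟩, htl⟩, hσl⟩, hσm⟩, hterm⟩ := h
  -- lean3's side as a list sum
  have hnd : (rw.2.map Prod.fst).Nodup := by rw [hcols]; exact List.nodup_range
  have hlt : ∀ p ∈ rw.2, p.1 < n := fun p hp => by
    have : p.1 ∈ rw.2.map Prod.fst := List.mem_map.mpr ⟨p, hp, rfl⟩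
    rw [hcols] at this; exact List.mem_range.mp this
  rw [hrhs, Rat.cast_zero, GLYZc1D3.sum_sget_mul (fun k => f (lab k)) rw.2 hnd hlt]
  -- lean2's side as a list sum over its own terms
  rw [sum_decWZ] at hE
  set g : ℕ × ℤ → ℝ := fun t => ((((t.2 : ℚ) / M : ℚ)) : ℝ) * f (BindN.wdg 3 t.1) with hg
  -- reorder lean2's terms by σ
  have hσmem : ∀ i < n, i ∈ σ := fun i hi => by simpa using hσm i hi
  have hperm : ts.Perm (σ.map fun i => ts.getD i (0, 0)) := by
    have h1 : (σ.map fun i => ts.getD i (0, 0)).Perm ((List.range n).map fun i => ts.getD i (0, 0)) :=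
      (perm_range_of_forall_mem hσl hσmem).map _
    rw [← htl, map_getD_range] at h1
    exact h1.symm
  rw [(hperm.map g).sum_eq] at hE
  -- both sides indexed by the columns `v < n`
  have hrwlen : rw.2.length = n := by rw [← List.length_map (f := Prod.fst), hcols, List.length_range]
  have hσ : σ = (List.range n).map fun v => σ.getD v 0 := by rw [← hσl, map_getD_range]
  have hrw : rw.2 = (List.range n).map fun v => rw.2.getD v (0, 0) := by rw [← hrwlen, map_getD_range]
  have hfst : ∀ v < n, (rw.2.getD v (0, 0)).1 = v := fun v hv => by
    have := List.getD_map (l := rw.2) (f := Prod.fst) (n := v) (d := ((0 : ℕ), (0 : ℚ)))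
    rw [hcols, List.getD_eq_getElem _ _ (by simpa using hv), List.getElem_range] at this
    exact this.symm
  rw [hσ, List.map_map, List.map_map] at hE
  rw [hrw, List.map_map, ← hE]
  refine congrArg List.sum (List.map_congr_left fun v hv => ?_)
  have hv : v < n := List.mem_range.mp hv
  obtain ⟨hc, hq⟩ := hterm v hv
  simp only [Function.comp_apply, hg]
  rw [hq, hfst v hv, hlab v hv, ← hc]

/-- API: the aggregated-row check fixes the right-hand side to `0` and the three lengths to `n`. -/
theorem aggOK_shape {n : ℕ} {code : ℕ → ℕ} {rw : ℚ × List (ℕ × ℚ)} {ts : List (ℕ × ℤ)} {M : ℕ} {σ : List ℕ}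
    (h : aggOK n code rw ts M σ = true) : rw.1 = 0 ∧ rw.2.length = n ∧ ts.length = n ∧ σ.length = n := by
  simp only [aggOK, Bool.and_eq_true, decide_eq_true_eq] at h
  obtain ⟨⟨⟨⟨⟨hrhs, hcols⟩, htl⟩, hσl⟩, _⟩, _⟩ := h
  refine ⟨hrhs, ?_, htl, hσl⟩
  rw [← List.length_map (f := Prod.fst), hcols, List.length_range]

/-- **`Fin`-valued form of `sum_eq_of_aggOK`** for a right-hand side known to be `0` (the aggregated rows of the kz
certificates): `Σ_v rw_v · f (lab v) = 0`. -/
theorem sum_eq_zero_of_aggOK {n : ℕ} {code : ℕ → ℕ} {lab : ℕ → Word 3} (hlab : ∀ v < n, lab v = BindN.wdg 3 (code v))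
    (f : Word 3 → ℝ) (cβ : ℝ) {rw : ℚ × List (ℕ × ℚ)} {ts : List (ℕ × ℤ)} {M : ℕ} {σ : List ℕ}
    (h : aggOK n code rw ts M σ = true)
    (hE : ((BindZ.decWZ 3 ts M).map fun t => (((t.2.1 : ℚ) : ℝ) + ((t.2.2 : ℚ) : ℝ) * cβ) * f t.1).sum = 0) :
    ∑ v : Fin n, (sget rw.2 v.val : ℝ) * f (lab v.val) = 0 := by
  rw [sum_eq_of_aggOK hlab f cβ h hE, (aggOK_shape h).1, Rat.cast_zero]

/-! ## Linear-walk variant for rows of ≈ 10³ terms (function-coded data)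

For the 1203-term aggregated rows of kz-L2-H-3D the list-indexed check `aggOK` (positional access `getD`, membership
`contains`: quadratic in `n`) exceeds the kernel's memory guard (`(kernel) excessive memory consumption detected` at
`n = 1203`).  The variant below reads the seat's data through FUNCTIONS `ℕ → _` (emitted by the generator as balanced
`if`-trees, `O(log n)` per access): `coef v` = lean3's coefficient of column `v`, `col j` = the column of lean2's term `j`,
`pos` = its inverse.  Three LINEAR walks are checked by the kernel, each as its own theorem: `rwWalk` (lean3's row is
`[(0, coef 0), (1, coef 1), …]`), `tsWalk` (lean2's term `j` has the label code of column `col j` and coefficient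
`coef (col j)`), `posOK` (every column `i < n` is hit: `pos i < n`, `col (pos i) = i`); `sum_eq_of_walks` is the soundness
statement in the shape of `sum_eq_of_aggOK`. -/

/-- Walk of lean3's sparse row from column `v`: the entries are `(v, coef v), (v+1, coef (v+1)), …`. -/
def rwWalk (coef : ℕ → ℚ) : ℕ → List (ℕ × ℚ) → Bool
  | _, [] => true
  | v, p :: l => decide (p.1 = v) && decide (p.2 = coef v) && rwWalk coef (v + 1) l

/-- Walk of lean2's coded terms from position `j`: term `j` carries the label code of column `col j` and the
coefficient `z / M = coef (col j)`. -/
def tsWalk (code : ℕ → ℕ) (coef : ℕ → ℚ) (col : ℕ → ℕ) (M : ℕ) : ℕ → List (ℕ × ℤ) → Bool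
  | _, [] => true
  | j, t :: l => decide (t.1 = code (col j)) && decide (((t.2 : ℚ) / M) = coef (col j)) &&
      tsWalk code coef col M (j + 1) l

/-- Every column `i < n` is the column of some term: `pos i < n` and `col (pos i) = i`. -/
def posOK (n : ℕ) (col pos : ℕ → ℕ) : Bool :=
  (List.range n).all fun i => decide (pos i < n) && decide (col (pos i) = i)

/-- `rwWalk` identifies the row with the tabulated function. [folklore] -/
theorem eq_of_rwWalk (coef : ℕ → ℚ) : ∀ (v : ℕ) (l : List (ℕ × ℚ)), rwWalk coef v l = true →
    l = (List.range' v l.length).map fun w => (w, coef w)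
  | _, [], _ => by simp
  | v, p :: l, h => by
    simp only [rwWalk, Bool.and_eq_true, decide_eq_true_eq] at h
    obtain ⟨⟨h1, h2⟩, h3⟩ := h
    have hp : p = (v, coef v) := Prod.ext h1 h2
    rw [List.length_cons, List.range'_succ, List.map_cons, ← eq_of_rwWalk coef (v + 1) l h3, hp]

/-- `tsWalk` identifies the valued term list with the tabulated functions read through `col`. [folklore] -/
theorem map_eq_of_tsWalk (code : ℕ → ℕ) (coef : ℕ → ℚ) (col : ℕ → ℕ) (M : ℕ) (g : ℕ → ℚ → ℝ) :
    ∀ (j : ℕ) (l : List (ℕ × ℤ)), tsWalk code coef col M j l = true →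
      (l.map fun t => g t.1 ((t.2 : ℚ) / M)) = (List.range' j l.length).map fun i => g (code (col i)) (coef (col i))
  | _, [], _ => by simp
  | j, t :: l, h => by
    simp only [tsWalk, Bool.and_eq_true, decide_eq_true_eq] at h
    obtain ⟨⟨h1, h2⟩, h3⟩ := h
    rw [List.length_cons, List.range'_succ, List.map_cons, List.map_cons, map_eq_of_tsWalk code coef col M g (j + 1) l h3,
      h1, h2]

/-- `posOK` makes `(range n).map col` a permutation of `range n` (given `n` terms). [folklore] -/
theorem perm_of_posOK {n : ℕ} {col pos : ℕ → ℕ} (h : posOK n col pos = true) :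
    ((List.range n).map col).Perm (List.range n) := by
  simp only [posOK, List.all_eq_true, List.mem_range, Bool.and_eq_true, decide_eq_true_eq] at h
  refine perm_range_of_forall_mem (by simp) fun i hi => ?_
  obtain ⟨hp, hc⟩ := h i hi
  exact List.mem_map.mpr ⟨pos i, List.mem_range.mpr hp, hc⟩

/-- **From the three linear walks to lean3's `heq`** (same shape as `sum_eq_of_aggOK`): right-hand side `0`, `n` columns
and `n` terms, the walks `rwWalk` / `tsWalk` / `posOK`, labels decoding through lean2's decoder, and lean2's decoded row
vanishing at the valuation `f` give `Σ_{v<n} rw_v · f (lab v) = rhs`. -/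
theorem sum_eq_of_walks {n : ℕ} {code : ℕ → ℕ} {lab : ℕ → Word 3} (hlab : ∀ v < n, lab v = BindN.wdg 3 (code v))
    (f : Word 3 → ℝ) (cβ : ℝ) {rw : ℚ × List (ℕ × ℚ)} {ts : List (ℕ × ℤ)} {M : ℕ} {coef : ℕ → ℚ} {col pos : ℕ → ℕ}
    (hrhs : rw.1 = 0) (hrwl : rw.2.length = n) (htl : ts.length = n)
    (hrw : rwWalk coef 0 rw.2 = true) (hts : tsWalk code coef col M 0 ts = true) (hpos : posOK n col pos = true)
    (hE : ((BindZ.decWZ 3 ts M).map fun t => (((t.2.1 : ℚ) : ℝ) + ((t.2.2 : ℚ) : ℝ) * cβ) * f t.1).sum = 0) :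
    ∑ v : Fin n, (sget rw.2 v.val : ℝ) * f (lab v.val) = (rw.1 : ℝ) := by
  have hrw' : rw.2 = (List.range n).map fun w => (w, coef w) := by
    rw [eq_of_rwWalk coef 0 rw.2 hrw, hrwl, List.range_eq_range']
  -- lean3's side as a list sum
  have hcols : rw.2.map Prod.fst = List.range n := by
    rw [hrw', List.map_map]; exact List.map_id' _
  have hnd : (rw.2.map Prod.fst).Nodup := by rw [hcols]; exact List.nodup_range
  have hlt : ∀ p ∈ rw.2, p.1 < n := fun p hp => by
    have : p.1 ∈ rw.2.map Prod.fst := List.mem_map.mpr ⟨p, hp, rfl⟩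
    rw [hcols] at this; exact List.mem_range.mp this
  rw [hrhs, Rat.cast_zero, GLYZc1D3.sum_sget_mul (fun k => f (lab k)) rw.2 hnd hlt]
  -- lean2's side as a list sum over its own terms, then over columns
  rw [sum_decWZ] at hE
  have hts' := map_eq_of_tsWalk code coef col M (fun c q => ((q : ℚ) : ℝ) * f (BindN.wdg 3 c)) 0 ts hts
  rw [hts', htl, ← List.range_eq_range'] at hE
  have hE' : (((List.range n).map col).map fun i => ((coef i : ℚ) : ℝ) * f (BindN.wdg 3 (code i))).sum = 0 := by
    rw [List.map_map]; exact hE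
  rw [((perm_of_posOK hpos).map _).sum_eq] at hE'
  rw [hrw', List.map_map, ← hE']
  refine congrArg List.sum (List.map_congr_left fun v hv => ?_)
  simp only [Function.comp_apply]
  rw [hlab v (List.mem_range.mp hv)]

end AggBind

end Summit.QuantumFields.GaugeBoot

end
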